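import Summits.BirchSwinnertonDyer.BirchSwinnertonDyer.Theses.CountingDoorF2AtThree
import Literature.NumberTheory.EllipticCurves.BhargavaHo2022.LargeFamilyCount
import HarnessLib

/-!
# BirchSwinnertonDyer / CountingDoorF2AtThree — support item `GenericMembersLargeF2`
# (stmt-BirchSwinnertonDyer-19550, re-typed rev 6): PROVED

Route `route-BirchSwinnertonDyer-CountingDoorF2AtThree` (cell bsd-rank2; TWIN leaf
`PAdicBSDRankTwoPositiveProportion`). The support item I0 in its printed, fact-antecedent form:
modulo the large-family inputs `LargeFamilyInputsF2` (= the bodies of the named facts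
`BhargavaHo2022.thm10_1_F2` — Thm. 10.1: trivial rational torsion and `rank ≥ 2` for 100 % of
`F₂` — and `BhargavaHo2022.thm9_1_F2` — Thm. 9.1: `#Φ(<X) ~ c_Φ X^{2/3}` for every large `Φ` with
nonempty local conditions), in every large subfamily `Φ ⊆ F₂` with a nonempty condition at every
prime the members with trivial rational torsion and `rank ≥ 2` have density `1`. One line on the
tree corollary `BhargavaHo2022.thm9_1_F2.hasDensityOn_torsionOrder_rank_of_isLarge`
(`Literature/NumberTheory/EllipticCurves/BhargavaHo2022/LargeFamilyCount.lean`, seat lit GEN 10,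
p430042): a `100 %` property of `F₂` is a `100 %` property of any subfamily of positive lower
relative density. PARTITION: none — r_an ≥ 2, summit axis S0; TWIN (D-0056): n/a. B1 honesty:
counting along the height; no `L`-function, Selmer group or analytic rank is mentioned.
-/

set_option linter.dupNamespace false

namespace Summit.BirchSwinnertonDyer.BirchSwinnertonDyer.Theorems

/-- **`GenericMembersLargeF2` holds** (stmt-BirchSwinnertonDyer-19550): modulo Bhargava–Ho 2022
Thm. 10.1 and Thm. 9.1 (the antecedent `LargeFamilyInputsF2`), in every large `Φ ⊆ F₂` with
nonempty local conditions, `100 %` of the members have trivial rational torsion and `rank ≥ 2`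
(`BhargavaHo2022.thm9_1_F2.hasDensityOn_torsionOrder_rank_of_isLarge`).
[cite: BhargavaHo2022, Thm. 10.1 (§10, p. 35) and Thm. 9.1 (§9.1, p. 31)] -/
theorem genericMembersLargeF2 :
    Summit.BirchSwinnertonDyer.BirchSwinnertonDyer.Theses.CountingDoorF2AtThree.GenericMembersLargeF2 :=
  fun hL ↦
    Literature.NumberTheory.EllipticCurves.BhargavaHo2022.thm9_1_F2.hasDensityOn_torsionOrder_rank_of_isLarge
      hL.2 hL.1

end Summit.BirchSwinnertonDyer.BirchSwinnertonDyer.Theorems
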